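/-
Copyright (c) 2026 the pub-hodgecm-mathlib formalisation cell (harness21).  Prover seat hodgecm-mathlib-LH4-p16 (g0), req620 Track A «(D-RAM) FOUR-FRAME» squad
(STAGE-1b, row (2) of the piece `f_{T₊}`, the (β₂) road; director s1968 EMIT «p16 = β₂ specific-cell class (M4)»; heir LEAD T20-16 (R-35); β₂-face sub-dealer LH4-p04 (g8),
face geometer LH4-p09 (g9)), 2026-09-04.
-/
import Summits.HodgeConjecture.HodgeConjecture.Theorems.F0P3cDyRamConeCellFlipUnits   -- ★ p860971 (LH4-p11 (g8)): §B free-predicate face, §C `exists_omegaFlip_admissible`; brings ★ p860839 `…ConeCellFlipBalance`, ★ p860765, ★ `…ConeWeightHalfSplit` (flip clauses, `hpair` letters), ★ T1, ★ DEFS `ToricCensusDefs`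
import HarnessLib

/-!
# Crux `H413`, line LH4 «(D-RAM) FOUR-FRAME» — STAGE-1b, row (2), the (β₂) road, brick (β₂-H) class (M4): «THE β₂ FACE ON TUBE CELLS» I — the WEIGHTED labelled balance of a
# depth cell `levelSetDep(j, b; μ)`, `b ≥ 1`: the weighted exchange engine, and the tube cells BELOW the glue conductor (CLOSED given the plane face)
# (II = ★-twin `F0P3cDyRamConeCellFaceTubeAbove`: at and above the conductor — reduction to the populated sub-cell, and the exact ω-flip is populatedness-reversing there)

Cell `hodgecm-mathlib` (D-0151), FLOOR 0, crux item H413 = `stmt-HodgeConjecture-24833`, route of record `HCCMUnconditional`; squad F0∕P3c∕LH4; lane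
`--supports stmt-HodgeConjecture-24833 --as helper` (count-neutral; pays NO tier-0 row).  THEOREMS ONLY (no `def`, no instance, no notation, no `sorry`, default heartbeats).

WHY.  In the labelled block census (★ p861044 `…BlockCensusOrderFormLabelled.ncard_fixed_selfDual_endoGL_sep_eq_orderForm`) a TUBE cell `(j, b)`, `b ≥ 1`, of the type-(2) cone
contributes the WEIGHTED count `Σᶠ_{Λ ∈ levelSetDep(j, b; lam − jE u) ∩ {q b j}} f b j Λ`, the weight `f b j Λ = #Sol_{2b}(r_Λ)` being the size of the glue fibre over the plane
lattice `Λ` (★ (C1) `hf`, VERBATIM below), while an AXIS cell `b = 0` contributes a plain count.  So the (β₂-H) face «literal-SPECIFIC cells are balanced, `N⁺ = N^{−′}`» is, on a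
tube cell, a WEIGHTED exchange balance `Σᶠ_{cell ∩ {+}} f = Σᶠ_{cell ∩ {−′}} f`.  The mechanism of record (F0P3-p01 (g36) GLUEFIBRE v1 91d9b231: labels are CONSTANT on glue
fibres — MECH-beta2H (M4)'s «opposite `E¹`-classes» is refuted numerically —, TORUS-FLIP ∕ OMEGA-CHECK ∕ ORBIT-SCAN ∕ HP-WITNESS-TABLE v1 5cca8016: the involution of a tube cell is the
PLANE flip `Λ ↦ ε • Λ`, exactly as on the axis cells) meets the weight through ★ T1's two regimes, and THIS FILE proves what each regime gives:
* §1 (abstract) the weighted two-label transport along a cell symmetry `τ` with `τ`-invariant weight (`finsum_mem_inter_eq_of_equiv_exchange`, Mathlib `finsum_mem_eq_of_bijOn`, no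
  finiteness) and `Σᶠ_{S} c = c·#S`.
* §2 (M-letters of ★ DEFS `F0P3cDyRamToricCensusDefs`, datum-free) its instance at the flip `Λ ↦ ε • Λ` (`ε·Θε = ξ`, `ρξ = ξ`, `|ξ| = 1`; cell-preserving by ★ p860839
  `smul_mem_levelSetDep_iff_of_flip`) for any `ε`-invariant weight, and the free-predicate form of ★ p860971 §B.
* §3 (M4-lo) BELOW THE GLUE CONDUCTOR `b + 1 ≤ d` (frame = ★ `ConeWeightHalfSplit.finsum_levelSetDep_weight_eq_pow_mul_ncard`'s: the E-side wild datum of ★ T1, the line model, the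
  weight letter `hf` of ★ (C1) verbatim): `f b j Λ = q^b` on the WHOLE cell (★ T1 class-blind `natCard_normFibre_eq_pow_of_succ_le` at the cell's canonical cone datum ★
  `exists_coneData_of_gen` ∕ `map_glueNorm_eq`), so `Σᶠ_{cell ∩ {P}} f = q^b·#(cell ∩ {P})` for ANY `P` and the weighted face IS the unweighted one: HEAD-lo
  `finsum_levelSetDep_inter_weight_eq_of_face_exchange_of_succ_le` — the tube cell is balanced GIVEN THE PLANE FACE in ★ p860971 §B's exchange letters (★
  `ncard_levelSetDep_sep_eq_of_face_exchange`); ω-instance `…_of_omegaFace_exchange_of_succ_le` over ★ `exists_omegaFlip_admissible` — the exact ω-flips (W1)(W2)(W3) of the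
  HP-WITNESS-TABLE, admissible precisely on these cells.
* (M4-hi) AT AND ABOVE THE CONDUCTOR `d ≤ b` is the ★-twin FILE II `F0P3cDyRamConeCellFaceTubeAbove` (imports this file): `f b j Λ ∈ {2q^b, 0}` (★ T1 norm-gated), the weighted
  face ⟺ the unweighted balance of the POPULATED sub-cell `{f ≠ 0}`, the socket «`τ` preserves the cell and `{f ≠ 0}` and exchanges the labels» (the near-similitude torus flip
  of the HP-WITNESS-TABLE rows `a₂ ≥ 2d` — NOT claimed), and TIGHTNESS: the exact ω-flip is populatedness-REVERSING there, so it must NOT be plugged into that socket.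
EVIDENCE (numerics, not hypotheses of any theorem here): F0P3-p01 (g36) HP-WITNESS-TABLE v1 5cca8016 rows (W1) `ε♮ = 1 + (i−1)ω` (`ξ = 3`), (W2) `1 + (2+√2)ζ₈` (`ξ = 3`), (W3)
`1 + (2+2√2)ω` (`ξ = −3`): exact ω-flips, admissible and label-reversing on every populated specific tube cell with `b + 1 ≤ d` of the 20 keys scanned, label-preserving on none.
HONEST LABEL.  Count-neutral lattice ∕ norm bookkeeping; nothing printed is asserted; no census law is stated; (β₂) stays a HYPOTHESIS and the (β₂-H) face is taken as a hypothesis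
(`hface`) throughout; `HC_CM` is proved only modulo the 7 printed citations (2 remaining named inputs: hLiu418 = `stmt-HodgeConjecture-24832`, h413 = `stmt-HodgeConjecture-24833`)
until rung 0 closes.
## References
* [Kottwitz1986BaseChangeUnits] R. E. Kottwitz, *Base change for unit elements of Hecke algebras*, Compositio Math. 60 (1986), §1 pp. 240–241 (fixed-lattice counts as orbital integrals).
* [Rogawski1990] J. D. Rogawski, *Automorphic Representations of Unitary Groups in Three Variables*, Ann. of Math. Stud. 123 (1990), §4.9 Prop. 4.9.1 (b) p. 55 (the labelled census of `f_{T₊}`).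
* [Serre1979] J.-P. Serre, *Local Fields*, GTM 67 (1979), Ch. V §3 Prop. 5, Cor. 2–3 pp. 84–86 (norm groups of a ramified quadratic extension; index two).
* [LabesseLanglands1979] J.-P. Labesse, R. P. Langlands, *L-indistinguishability for SL(2)*, Canad. J. Math. 31 (1979), §2 p. 8 (the norm-residue dichotomy).
* [Jacobowitz1962] R. Jacobowitz, *Hermitian forms over local fields*, Amer. J. Math. 84 (1962), §4 (dual lattices, gluing of modular components).
-/

set_option autoImplicit false

noncomputable section

open scoped Pointwise Valued WithZero Matrix MatrixGroups
open WithZero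
open scoped Classical
open Literature.NumberTheory.Automorphic Literature.NumberTheory.Automorphic.HermitianLattice Literature.NumberTheory.Automorphic.UnitaryLatticeTree
open Literature.NumberTheory.Automorphic.UnitaryThreeFourFrame (IsRamifiedQuadraticDatum)
open Literature.NumberTheory.Automorphic.EllipticPlaneAsFieldLine
open Literature.NumberTheory.LocalFields.QuadraticOrder
open Literature.NumberTheory.LocalFields.WildQuadraticDatum
open Summit.HodgeConjecture.HodgeConjecture.Cruxes.H413.F0P3cDyRamToricCensusDefs
open Summit.HodgeConjecture.HodgeConjecture.Cruxes.H413.F0P3cDyRamConeLevelTransport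
open Summit.HodgeConjecture.HodgeConjecture.Cruxes.H413.F0P3cDyRamConeCellLabelBalance (pointwise_smul_eq_map_mulLeft ncard_sep_eq_ncard_sep_of_equiv)
open Summit.HodgeConjecture.HodgeConjecture.Cruxes.H413.F0P3cDyRamConeWeightHalfSplit
open Summit.HodgeConjecture.HodgeConjecture.Cruxes.H413.F0P3cDyRamConeCellFlipBalance
open Summit.HodgeConjecture.HodgeConjecture.Cruxes.H413.F0P3cDyRamConeCellFlipUnits

namespace Summit.HodgeConjecture.HodgeConjecture.Cruxes.H413.F0P3cDyRamConeCellFaceTube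

/-! ## §1 Abstract: constant weights, and the weighted two-label transport along a cell symmetry -/

section Abstract

variable {X : Type*}

/-- **A CONSTANT WEIGHT SUMS TO `c·#S`** (`Set.ncard`; no finiteness: both sides vanish on an infinite `S` when `c ≠ 0`, and when `c = 0`).
[cite: Kottwitz1986BaseChangeUnits, §1 pp. 240–241] -/
theorem finsum_mem_const_eq_mul_ncard (S : Set X) (c : ℕ) : ∑ᶠ _x ∈ S, c = c * S.ncard := by
  by_cases hS : S.Finite
  · rw [finsum_mem_eq_finite_toFinset_sum _ hS, Set.ncard_eq_toFinset_card S hS, Finset.sum_const, smul_eq_mul, mul_comm]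
  · by_cases hc : c = 0
    · rw [hc, zero_mul]
      exact finsum_mem_eq_zero_of_forall_eq_zero fun _ _ => rfl
    · rw [Set.Infinite.ncard hS, mul_zero]
      refine finsum_mem_eq_zero_of_infinite ?_
      rwa [Function.support_const hc, Set.inter_univ]

/-- **WEIGHTED TWO-LABEL TRANSPORT ALONG A CELL SYMMETRY.**  If `τ : X ≃ X` preserves the cell `S`, the weight `w` is `τ`-invariant on `S`, `τ` carries label `P` to label `Q` on `S`
and `τ⁻¹` carries `Q` back to `P` on `S`, then `Σᶠ_{x ∈ S ∩ {P}} w x = Σᶠ_{x ∈ S ∩ {Q}} w x` (as `finsum`; no finiteness needed — Mathlib `finsum_mem_eq_of_bijOn`).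
[cite: Kottwitz1986BaseChangeUnits, §1 pp. 240–241] -/
theorem finsum_mem_inter_eq_of_equiv_exchange {N : Type*} [AddCommMonoid N] (S : Set X) (τ : X ≃ X) (hτ : ∀ x, τ x ∈ S ↔ x ∈ S)
    (w : X → N) (hw : ∀ x ∈ S, w (τ x) = w x) (P Q : X → Prop)
    (hPQ : ∀ x ∈ S, P x → Q (τ x)) (hQP : ∀ y ∈ S, Q y → P (τ.symm y)) :
    ∑ᶠ x ∈ S ∩ {x | P x}, w x = ∑ᶠ x ∈ S ∩ {x | Q x}, w x := by
  refine finsum_mem_eq_of_bijOn τ ⟨fun x hx => ⟨(hτ x).2 hx.1, hPQ x hx.1 hx.2⟩, fun a _ b _ h => τ.injective h, fun y hy => ?_⟩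
    fun x hx => (hw x hx.1).symm
  have hyS : τ.symm y ∈ S := (hτ (τ.symm y)).1 (by rw [τ.apply_symm_apply]; exact hy.1)
  exact ⟨τ.symm y, ⟨hyS, hQP y hy.1 hy.2⟩, τ.apply_symm_apply y⟩

/-- **WEIGHTED HALF∕HALF FROM A LABEL-REVERSING SYMMETRY** (one-label form: `P (τ x) ↔ ¬ P x` on `S` ⇒ `Σᶠ_{S ∩ {P}} w = Σᶠ_{S ∩ {¬P}} w`).
[cite: Kottwitz1986BaseChangeUnits, §1 pp. 240–241] -/
theorem finsum_mem_inter_eq_of_equiv_labelReversing {N : Type*} [AddCommMonoid N] (S : Set X) (τ : X ≃ X) (hτ : ∀ x, τ x ∈ S ↔ x ∈ S)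
    (w : X → N) (hw : ∀ x ∈ S, w (τ x) = w x) (P : X → Prop) (hrev : ∀ x ∈ S, P (τ x) ↔ ¬ P x) :
    ∑ᶠ x ∈ S ∩ {x | P x}, w x = ∑ᶠ x ∈ S ∩ {x | ¬ P x}, w x := by
  refine finsum_mem_inter_eq_of_equiv_exchange S τ hτ w hw P (fun x => ¬ P x) (fun x hx hP hτx => (hrev x hx).1 hτx hP) (fun y hy hQ => ?_)
  have hyS : τ.symm y ∈ S := (hτ (τ.symm y)).1 (by rw [τ.apply_symm_apply]; exact hy)
  have h := hrev (τ.symm y) hyS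
  rw [τ.apply_symm_apply] at h
  by_contra hP
  exact hQ (h.2 hP)

end Abstract

/-! ## §2 The flip instance on a depth cell `levelSetDep(j, a; μ)` (datum-free M-letters of ★ DEFS `F0P3cDyRamToricCensusDefs`) -/

section Flip

variable {K : Type*} [Field K] [Valued K ℤᵐ⁰] {ρ Θ : K →+* K} {α : K}

/-- **WEIGHTED TWO-LABEL BALANCE OF A DEPTH CELL UNDER A FLIP.**  For a flip `ε` (`ε·Θε = ξ`, `ρξ = ξ`, `|ξ| = 1` — cell-preserving by ★ p860839 `smul_mem_levelSetDep_iff_of_flip`),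
an `ε`-invariant weight `w` on the cell and two labels with `P Λ → Q (ε • Λ)`, `Q Λ → P (ε⁻¹ • Λ)` on the cell: `Σᶠ_{Λ ∈ cell ∩ {P}} w Λ = Σᶠ_{Λ ∈ cell ∩ {Q}} w Λ`.
[cite: Rogawski1990, §4.9 Prop. 4.9.1 (b) p. 55] [cite: Kottwitz1986BaseChangeUnits, §1 pp. 240–241] -/
theorem finsum_levelSetDep_inter_eq_of_flip_exchange {N : Type*} [AddCommMonoid N] {ε ξ : K} (hε : ε * Θ ε = ξ) (hρξ : ρ ξ = ξ) (hξ1 : Valued.v ξ = 1)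
    (ϖE h : K) (j a : ℕ) (μ : K) (w : AddSubgroup K → N) (hw : ∀ Λ ∈ levelSetDep ρ Θ α ϖE h j a μ, w (ε • Λ) = w Λ) (P Q : AddSubgroup K → Prop)
    (hPQ : ∀ Λ ∈ levelSetDep ρ Θ α ϖE h j a μ, P Λ → Q (ε • Λ)) (hQP : ∀ Λ ∈ levelSetDep ρ Θ α ϖE h j a μ, Q Λ → P (ε⁻¹ • Λ)) :
    ∑ᶠ Λ ∈ levelSetDep ρ Θ α ϖE h j a μ ∩ {Λ | P Λ}, w Λ = ∑ᶠ Λ ∈ levelSetDep ρ Θ α ϖE h j a μ ∩ {Λ | Q Λ}, w Λ := by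
  have hξ0 : ξ ≠ 0 := fun h0 => by rw [h0, map_zero] at hξ1; exact zero_ne_one hξ1
  have hε0 : ε ≠ 0 := ne_zero_of_mul_map_eq hε hξ0
  let τ : AddSubgroup K ≃ AddSubgroup K :=
    ⟨fun Λ => ε • Λ, fun Λ => ε⁻¹ • Λ, fun Λ => by simp only [smul_smul, inv_mul_cancel₀ hε0, one_smul],
      fun Λ => by simp only [smul_smul, mul_inv_cancel₀ hε0, one_smul]⟩
  exact finsum_mem_inter_eq_of_equiv_exchange _ τ (fun Λ => smul_mem_levelSetDep_iff_of_flip hε hρξ hξ1 ϖE h j a μ Λ) w hw P Q hPQ hQP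

/-- **FREE-PREDICATE FORM** (★ p860971 §B shape): if SOME admissible flip satisfies the face's predicate `Pf`, and for EVERY admissible `ε` with `Pf ε` the weight is `ε`-invariant on
the cell and the face exchanges the labels, then `Σᶠ_{cell ∩ {P₁}} w = Σᶠ_{cell ∩ {Q₁}} w`. [cite: Rogawski1990, §4.9 Prop. 4.9.1 (b) p. 55] [cite: Kottwitz1986BaseChangeUnits, §1 pp. 240–241] -/
theorem finsum_levelSetDep_inter_eq_of_face_exchange {N : Type*} [AddCommMonoid N] (Pf : K → Prop) (hP : ∃ ε ξ : K, Pf ε ∧ ε * Θ ε = ξ ∧ ρ ξ = ξ ∧ Valued.v ξ = 1)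
    (ϖE h : K) (j a : ℕ) (μ : K) (w : AddSubgroup K → N)
    (hw : ∀ ε ξ : K, Pf ε → ε * Θ ε = ξ → ρ ξ = ξ → Valued.v ξ = 1 → ∀ Λ ∈ levelSetDep ρ Θ α ϖE h j a μ, w (ε • Λ) = w Λ)
    (P₁ Q₁ : AddSubgroup K → Prop)
    (hface : ∀ ε ξ : K, Pf ε → ε * Θ ε = ξ → ρ ξ = ξ → Valued.v ξ = 1 →
      (∀ Λ ∈ levelSetDep ρ Θ α ϖE h j a μ, P₁ Λ → Q₁ (ε • Λ)) ∧ (∀ Λ ∈ levelSetDep ρ Θ α ϖE h j a μ, Q₁ Λ → P₁ (ε⁻¹ • Λ))) :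
    ∑ᶠ Λ ∈ levelSetDep ρ Θ α ϖE h j a μ ∩ {Λ | P₁ Λ}, w Λ = ∑ᶠ Λ ∈ levelSetDep ρ Θ α ϖE h j a μ ∩ {Λ | Q₁ Λ}, w Λ := by
  obtain ⟨ε, ξ, hPε, hε, hρξ, hξ1⟩ := hP
  obtain ⟨hPQ, hQP⟩ := hface ε ξ hPε hε hρξ hξ1
  exact finsum_levelSetDep_inter_eq_of_flip_exchange hε hρξ hξ1 ϖE h j a μ w (hw ε ξ hPε hε hρξ hξ1) P₁ Q₁ hPQ hQP

end Flip

/-! ## §3–§4 The weight of ★ (C1) on a depth cell: the two regimes of ★ T1 (frame = ★ `ConeWeightHalfSplit.finsum_levelSetDep_weight_eq_pow_mul_ncard`) -/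

section Weight

variable {E : Type} {M : Type*} [Field E] [Valued E ℤᵐ⁰] [Field M] [Valued M ℤᵐ⁰] {ρ Θ : M →+* M} {α : M}

/-- **THE GLUE WEIGHT OF A PRESENTED DEPTH CELL MEMBER, EVALUATED AT ITS CANONICAL CONE DATUM.**  In the frame of ★ (C1) ∕ ★ `ConeWeightHalfSplit` (E-side letters, line model,
weight letter `hf` VERBATIM), every `Λ ∈ levelSetDep(j, b; lam − jE u)` (`b ≥ 1`, `lam ∈ 𝒪_j`) is presented by a generator `x₀` (with its order ∕ integrality ∕ primitivity ∕
level ∕ depth clauses) carrying a `σ`-fixed UNIT `r₀ ∈ E` with `jE r₀ = glueUnit(x₀, b)` and `f b j Λ = #Sol_{2b}(r₀)` (★ `exists_coneData_of_gen` + `map_glueNorm_eq` + `hf`). [cite: Jacobowitz1962, §4] [cite: Kottwitz1986BaseChangeUnits, §1 pp. 240–241] -/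
theorem exists_fixed_unit_weight_eq_natCard_normFibre (σ : E →+* E) (hσ : ∀ a, σ (σ a) = a) (hvσ : ∀ a, Valued.v (σ a) = Valued.v a)
    {ϖ : E} (hϖ : Valued.v ϖ = WithZero.exp (-1 : ℤ))
    {H₂ : Matrix (Fin 2) (Fin 2) E} (hH₂σ : (H₂.map σ)ᵀ = H₂) {hW : E} (hhW : Valued.v hW = 1) (hhWσ : σ hW = hW) (jE : E →+* M)
    (hρρ : ∀ x, ρ (ρ x) = x) (hvρ : ∀ x, Valued.v (ρ x) = Valued.v x) (hα : ρ α ≠ α) (hα1 : Valued.v α ≤ 1)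
    (hint : ∀ z : M, Valued.v z ≤ 1 → Valued.v ((z - ρ z) / (α - ρ α)) ≤ 1)
    (hΘΘ : ∀ x, Θ (Θ x) = x) (hΘρ : ∀ x, Θ (ρ x) = ρ (Θ x)) (hvΘ : ∀ x, Valued.v (Θ x) = Valued.v x) (hΘj : ∀ x, Θ (jE x) = jE (σ x))
    (hjv : ∀ c, Valued.v (jE c) ≤ 1 ↔ Valued.v c ≤ 1) (hjfix : ∀ z, ρ z = z ↔ ∃ c, jE c = z)
    (hjpow : ∀ (t : E) (n : ℤ), Valued.v (jE t) = Valued.v (jE ϖ) ^ n ↔ Valued.v t = Valued.v ϖ ^ n)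
    (hϖmax : ∀ t : M, ρ t = t → Valued.v t < 1 → Valued.v t ≤ Valued.v (jE ϖ))
    (φ : (Fin 2 → E) →+ M) (hφs : ∀ (c : E) (x : Fin 2 → E), φ (c • x) = jE c * φ x) (hφi : Function.Injective φ) (hφo : Function.Surjective φ)
    {γ₂ : GL (Fin 2) E} {lam h : M} (hφγ : ∀ x, φ ((γ₂ : Matrix (Fin 2) (Fin 2) E).mulVec x) = lam * φ x) (hlam : Valued.v lam = 1)
    (hΘh : Θ h = h) (hh : h ≠ 0) (hform : ∀ x y, jE (pairing σ H₂ x y) = h * Θ (φ x) * φ y + ρ (h * Θ (φ x) * φ y))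
    (u : E) {b : ℕ} (hb : 1 ≤ b) {j : ℕ} (hlamj : IsOrd ρ α (jE ϖ ^ j) lam)
    (f : ℕ → ℕ → AddSubgroup M → ℕ)
    (hf : ∀ (b j : ℕ) (Λ : AddSubgroup M) (x₀ : M) (r : E), 1 ≤ b → x₀ ≠ 0 →
      (∀ x, x ∈ Λ ↔ ∃ z, IsOrd ρ α (jE ϖ ^ j) z ∧ x = x₀ * z) →
      IsOrd ρ α (jE ϖ ^ j) (dualGen ρ Θ α (jE ϖ ^ j) h x₀) → ¬ IsOrd ρ α (jE ϖ ^ j) (dualGen ρ Θ α (jE ϖ ^ j) h x₀ / jE ϖ) →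
      Valued.v (dualGen ρ Θ α (jE ϖ ^ j) h x₀) = Valued.v (jE ϖ) ^ b →
      (∀ b', (∀ x ∈ Λ, Valued.v (h * Θ x * b' + ρ (h * Θ x * b')) ≤ 1) → (lam - jE u) * b' ∈ Λ) →
      IsOrd ρ α (jE ϖ ^ j) lam → jE r = glueUnit ρ Θ α (jE ϖ ^ j) h (jE ϖ) (jE hW) x₀ b →
      f b j Λ = Nat.card {x : 𝒪[E] ⧸ 𝓂[E] ^ (2 * b) // ∃ u' : 𝒪[E], Ideal.Quotient.mk (𝓂[E] ^ (2 * b)) u' = x ∧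
        Valued.v ((u' : E) * σ u' - r) ≤ Valued.v (ϖ ^ (2 * b))})
    {Λ : AddSubgroup M} (hΛ : Λ ∈ levelSetDep ρ Θ α (jE ϖ) h j b (lam - jE u)) :
    ∃ (x₀ : M) (r₀ : E), x₀ ≠ 0 ∧ (∀ x, x ∈ Λ ↔ ∃ z, IsOrd ρ α (jE ϖ ^ j) z ∧ x = x₀ * z) ∧
      IsOrd ρ α (jE ϖ ^ j) (dualGen ρ Θ α (jE ϖ ^ j) h x₀) ∧ ¬ IsOrd ρ α (jE ϖ ^ j) (dualGen ρ Θ α (jE ϖ ^ j) h x₀ / jE ϖ) ∧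
      Valued.v (dualGen ρ Θ α (jE ϖ ^ j) h x₀) = Valued.v (jE ϖ) ^ b ∧
      (∀ b', (∀ x ∈ Λ, Valued.v (h * Θ x * b' + ρ (h * Θ x * b')) ≤ 1) → (lam - jE u) * b' ∈ Λ) ∧
      σ r₀ = r₀ ∧ Valued.v r₀ = 1 ∧ jE r₀ = glueUnit ρ Θ α (jE ϖ ^ j) h (jE ϖ) (jE hW) x₀ b ∧
      f b j Λ = Nat.card {x : 𝒪[E] ⧸ 𝓂[E] ^ (2 * b) // ∃ u' : 𝒪[E], Ideal.Quotient.mk (𝓂[E] ^ (2 * b)) u' = x ∧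
        Valued.v ((u' : E) * σ u' - r₀) ≤ Valued.v (ϖ ^ (2 * b))} := by
  have hvϖ0 : Valued.v ϖ ≠ 0 := by rw [hϖ]; exact WithZero.exp_ne_zero
  have hϖ0 : ϖ ≠ 0 := fun h0 => by rw [h0, map_zero] at hvϖ0; exact hvϖ0 rfl
  have hϖ1 : Valued.v ϖ < 1 := by rw [hϖ, ← WithZero.exp_zero, WithZero.exp_lt_exp]; norm_num
  have hH : ∀ a b', σ (H₂ a b') = H₂ b' a := by
    intro a b'
    have := congrFun (congrFun hH₂σ b') a
    simpa [Matrix.transpose_apply, Matrix.map_apply] using this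
  obtain ⟨⟨x₀, hx₀, hΛx, hyO, hyprim, hylev⟩, hdepΛ⟩ := hΛ
  -- the canonical cone data of the cell: a `σ`-fixed unit `r₀ ∈ E` with `jE r₀ = glueUnit(x₀, b)`
  obtain ⟨B', -, -, -, w₀, hw₀Y, -, -, hw₀, -⟩ := exists_coneData_of_gen σ hϖ0 hϖ1 H₂ jE hρρ hvρ hα hα1 hint hΘΘ hΘρ hvΘ hjv hjfix hjpow hϖmax
    φ hφs hφi hφo hφγ hlam hΘh hh hform u hb hx₀ hΛx hyO hyprim hylev hdepΛ hlamj
  set r₀ : E := -(pairing σ H₂ w₀ w₀) * (ϖ ^ b * σ (ϖ ^ b)) / hW with hr₀def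
  have hr₀ : jE r₀ = glueUnit ρ Θ α (jE ϖ ^ j) h (jE ϖ) (jE hW) x₀ b := map_glueNorm_eq σ H₂ jE hΘj φ hform hw₀Y ϖ hW b
  have hpair₀ : σ (pairing σ H₂ w₀ w₀) = pairing σ H₂ w₀ w₀ := (pairing_comm_of_hermitian hσ hH w₀ w₀).symm
  have hσr₀ : σ r₀ = r₀ := by
    rw [hr₀def, map_div₀, map_mul, map_neg, hpair₀, map_mul, hσ, hhWσ, mul_comm (σ (ϖ ^ b)) (ϖ ^ b)]
  have hr₀1 : Valued.v r₀ = 1 := by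
    rw [hr₀def, map_div₀, map_mul, Valuation.map_neg, map_mul, hvσ, map_pow, hhW, div_one, ← pow_add, ← two_mul]
    exact hw₀
  exact ⟨x₀, r₀, hx₀, hΛx, hyO, hyprim, hylev, hdepΛ, hσr₀, hr₀1, hr₀, hf b j Λ x₀ r₀ hb hx₀ hΛx hyO hyprim hylev hdepΛ hlamj hr₀⟩

/-! ### §3 (M4-lo) Below the glue conductor `b + 1 ≤ d`: the weight is the constant `q^b`, the weighted face is the unweighted one -/

/-- **(M4-lo) BELOW THE GLUE CONDUCTOR THE GLUE WEIGHT IS CONSTANT ON THE CELL: `f b j Λ = q^b`** for every `Λ ∈ levelSetDep(j, b; lam − jE u)`, `1 ≤ b`, `b + 1 ≤ d`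
(★ T1 class-blind `natCard_normFibre_eq_pow_of_succ_le` at the cell member's canonical cone datum).  Frame: the E-side wild datum of ★ T1 (`IsRamifiedQuadraticDatum σ ϖ d t`,
`|2| < 1`, finite residue field of size `q = Nat.card 𝓀[E]`), the line model, ★ (C1)'s `hf` verbatim. [cite: Serre1979, Ch. V §3 Prop. 5, Cor. 2–3 pp. 84–86]
[cite: LabesseLanglands1979, §2 p. 8] [cite: Kottwitz1986BaseChangeUnits, §1 pp. 240–241] -/
theorem weight_eq_pow_of_mem_levelSetDep_of_succ_le [IsDiscreteValuationRing 𝒪[E]] [Finite 𝓀[E]]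
    (σ : E →+* E) (hσ : ∀ a, σ (σ a) = a) (hvσ : ∀ a, Valued.v (σ a) = Valued.v a)
    {ϖ : E} (hϖ : Valued.v ϖ = WithZero.exp (-1 : ℤ)) {d t : ℕ} (hD : IsRamifiedQuadraticDatum σ ϖ d t) (h2v : Valued.v (2 : E) < 1)
    {H₂ : Matrix (Fin 2) (Fin 2) E} (hH₂σ : (H₂.map σ)ᵀ = H₂) {hW : E} (hhW : Valued.v hW = 1) (hhWσ : σ hW = hW) (jE : E →+* M)
    (hρρ : ∀ x, ρ (ρ x) = x) (hvρ : ∀ x, Valued.v (ρ x) = Valued.v x) (hα : ρ α ≠ α) (hα1 : Valued.v α ≤ 1)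
    (hint : ∀ z : M, Valued.v z ≤ 1 → Valued.v ((z - ρ z) / (α - ρ α)) ≤ 1)
    (hΘΘ : ∀ x, Θ (Θ x) = x) (hΘρ : ∀ x, Θ (ρ x) = ρ (Θ x)) (hvΘ : ∀ x, Valued.v (Θ x) = Valued.v x) (hΘj : ∀ x, Θ (jE x) = jE (σ x))
    (hjv : ∀ c, Valued.v (jE c) ≤ 1 ↔ Valued.v c ≤ 1) (hjfix : ∀ z, ρ z = z ↔ ∃ c, jE c = z)
    (hjpow : ∀ (t : E) (n : ℤ), Valued.v (jE t) = Valued.v (jE ϖ) ^ n ↔ Valued.v t = Valued.v ϖ ^ n)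
    (hϖmax : ∀ t : M, ρ t = t → Valued.v t < 1 → Valued.v t ≤ Valued.v (jE ϖ))
    (φ : (Fin 2 → E) →+ M) (hφs : ∀ (c : E) (x : Fin 2 → E), φ (c • x) = jE c * φ x) (hφi : Function.Injective φ) (hφo : Function.Surjective φ)
    {γ₂ : GL (Fin 2) E} {lam h : M} (hφγ : ∀ x, φ ((γ₂ : Matrix (Fin 2) (Fin 2) E).mulVec x) = lam * φ x) (hlam : Valued.v lam = 1)
    (hΘh : Θ h = h) (hh : h ≠ 0) (hform : ∀ x y, jE (pairing σ H₂ x y) = h * Θ (φ x) * φ y + ρ (h * Θ (φ x) * φ y))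
    (u : E) {b : ℕ} (hb : 1 ≤ b) (hbd : b + 1 ≤ d) {j : ℕ} (hlamj : IsOrd ρ α (jE ϖ ^ j) lam)
    (f : ℕ → ℕ → AddSubgroup M → ℕ)
    (hf : ∀ (b j : ℕ) (Λ : AddSubgroup M) (x₀ : M) (r : E), 1 ≤ b → x₀ ≠ 0 →
      (∀ x, x ∈ Λ ↔ ∃ z, IsOrd ρ α (jE ϖ ^ j) z ∧ x = x₀ * z) →
      IsOrd ρ α (jE ϖ ^ j) (dualGen ρ Θ α (jE ϖ ^ j) h x₀) → ¬ IsOrd ρ α (jE ϖ ^ j) (dualGen ρ Θ α (jE ϖ ^ j) h x₀ / jE ϖ) →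
      Valued.v (dualGen ρ Θ α (jE ϖ ^ j) h x₀) = Valued.v (jE ϖ) ^ b →
      (∀ b', (∀ x ∈ Λ, Valued.v (h * Θ x * b' + ρ (h * Θ x * b')) ≤ 1) → (lam - jE u) * b' ∈ Λ) →
      IsOrd ρ α (jE ϖ ^ j) lam → jE r = glueUnit ρ Θ α (jE ϖ ^ j) h (jE ϖ) (jE hW) x₀ b →
      f b j Λ = Nat.card {x : 𝒪[E] ⧸ 𝓂[E] ^ (2 * b) // ∃ u' : 𝒪[E], Ideal.Quotient.mk (𝓂[E] ^ (2 * b)) u' = x ∧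
        Valued.v ((u' : E) * σ u' - r) ≤ Valued.v (ϖ ^ (2 * b))}) :
    ∀ Λ ∈ levelSetDep ρ Θ α (jE ϖ) h j b (lam - jE u), f b j Λ = Nat.card 𝓀[E] ^ b := by
  intro Λ hΛ
  obtain ⟨-, r₀, -, -, -, -, -, -, hσr₀, hr₀1, -, hfΛ⟩ := exists_fixed_unit_weight_eq_natCard_normFibre σ hσ hvσ hϖ hH₂σ hhW hhWσ jE hρρ hvρ hα hα1 hint hΘΘ hΘρ hvΘ
    hΘj hjv hjfix hjpow hϖmax φ hφs hφi hφo hφγ hlam hΘh hh hform u hb hlamj f hf hΛ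
  rw [hfΛ]
  exact natCard_normFibre_eq_pow_of_succ_le hD h2v hσr₀ hr₀1 hb hbd

/-- **(M4-lo) BELOW THE CONDUCTOR EVERY LABELLED WEIGHT OF THE CELL IS `q^b ·` THE LABELLED COUNT**: `Σᶠ_{Λ ∈ cell ∩ {P}} f b j Λ = q^b · #(cell ∩ {P})` for ANY label `P`
(`1 ≤ b`, `b + 1 ≤ d`). [cite: Serre1979, Ch. V §3 Prop. 5, Cor. 2–3 pp. 84–86] [cite: Kottwitz1986BaseChangeUnits, §1 pp. 240–241] -/
theorem finsum_levelSetDep_inter_weight_eq_pow_mul_ncard_of_succ_le [IsDiscreteValuationRing 𝒪[E]] [Finite 𝓀[E]]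
    (σ : E →+* E) (hσ : ∀ a, σ (σ a) = a) (hvσ : ∀ a, Valued.v (σ a) = Valued.v a)
    {ϖ : E} (hϖ : Valued.v ϖ = WithZero.exp (-1 : ℤ)) {d t : ℕ} (hD : IsRamifiedQuadraticDatum σ ϖ d t) (h2v : Valued.v (2 : E) < 1)
    {H₂ : Matrix (Fin 2) (Fin 2) E} (hH₂σ : (H₂.map σ)ᵀ = H₂) {hW : E} (hhW : Valued.v hW = 1) (hhWσ : σ hW = hW) (jE : E →+* M)
    (hρρ : ∀ x, ρ (ρ x) = x) (hvρ : ∀ x, Valued.v (ρ x) = Valued.v x) (hα : ρ α ≠ α) (hα1 : Valued.v α ≤ 1)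
    (hint : ∀ z : M, Valued.v z ≤ 1 → Valued.v ((z - ρ z) / (α - ρ α)) ≤ 1)
    (hΘΘ : ∀ x, Θ (Θ x) = x) (hΘρ : ∀ x, Θ (ρ x) = ρ (Θ x)) (hvΘ : ∀ x, Valued.v (Θ x) = Valued.v x) (hΘj : ∀ x, Θ (jE x) = jE (σ x))
    (hjv : ∀ c, Valued.v (jE c) ≤ 1 ↔ Valued.v c ≤ 1) (hjfix : ∀ z, ρ z = z ↔ ∃ c, jE c = z)
    (hjpow : ∀ (t : E) (n : ℤ), Valued.v (jE t) = Valued.v (jE ϖ) ^ n ↔ Valued.v t = Valued.v ϖ ^ n)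
    (hϖmax : ∀ t : M, ρ t = t → Valued.v t < 1 → Valued.v t ≤ Valued.v (jE ϖ))
    (φ : (Fin 2 → E) →+ M) (hφs : ∀ (c : E) (x : Fin 2 → E), φ (c • x) = jE c * φ x) (hφi : Function.Injective φ) (hφo : Function.Surjective φ)
    {γ₂ : GL (Fin 2) E} {lam h : M} (hφγ : ∀ x, φ ((γ₂ : Matrix (Fin 2) (Fin 2) E).mulVec x) = lam * φ x) (hlam : Valued.v lam = 1)
    (hΘh : Θ h = h) (hh : h ≠ 0) (hform : ∀ x y, jE (pairing σ H₂ x y) = h * Θ (φ x) * φ y + ρ (h * Θ (φ x) * φ y))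
    (u : E) {b : ℕ} (hb : 1 ≤ b) (hbd : b + 1 ≤ d) {j : ℕ} (hlamj : IsOrd ρ α (jE ϖ ^ j) lam)
    (f : ℕ → ℕ → AddSubgroup M → ℕ)
    (hf : ∀ (b j : ℕ) (Λ : AddSubgroup M) (x₀ : M) (r : E), 1 ≤ b → x₀ ≠ 0 →
      (∀ x, x ∈ Λ ↔ ∃ z, IsOrd ρ α (jE ϖ ^ j) z ∧ x = x₀ * z) →
      IsOrd ρ α (jE ϖ ^ j) (dualGen ρ Θ α (jE ϖ ^ j) h x₀) → ¬ IsOrd ρ α (jE ϖ ^ j) (dualGen ρ Θ α (jE ϖ ^ j) h x₀ / jE ϖ) →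
      Valued.v (dualGen ρ Θ α (jE ϖ ^ j) h x₀) = Valued.v (jE ϖ) ^ b →
      (∀ b', (∀ x ∈ Λ, Valued.v (h * Θ x * b' + ρ (h * Θ x * b')) ≤ 1) → (lam - jE u) * b' ∈ Λ) →
      IsOrd ρ α (jE ϖ ^ j) lam → jE r = glueUnit ρ Θ α (jE ϖ ^ j) h (jE ϖ) (jE hW) x₀ b →
      f b j Λ = Nat.card {x : 𝒪[E] ⧸ 𝓂[E] ^ (2 * b) // ∃ u' : 𝒪[E], Ideal.Quotient.mk (𝓂[E] ^ (2 * b)) u' = x ∧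
        Valued.v ((u' : E) * σ u' - r) ≤ Valued.v (ϖ ^ (2 * b))})
    (P : AddSubgroup M → Prop) :
    ∑ᶠ Λ ∈ levelSetDep ρ Θ α (jE ϖ) h j b (lam - jE u) ∩ {Λ | P Λ}, f b j Λ =
      Nat.card 𝓀[E] ^ b * (levelSetDep ρ Θ α (jE ϖ) h j b (lam - jE u) ∩ {Λ | P Λ}).ncard := by
  rw [← finsum_mem_const_eq_mul_ncard]
  refine finsum_mem_congr rfl fun Λ hΛ => ?_
  exact weight_eq_pow_of_mem_levelSetDep_of_succ_le σ hσ hvσ hϖ hD h2v hH₂σ hhW hhWσ jE hρρ hvρ hα hα1 hint hΘΘ hΘρ hvΘ hΘj hjv hjfix hjpow hϖmax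
    φ hφs hφi hφo hφγ hlam hΘh hh hform u hb hbd hlamj f hf Λ hΛ.1

/-- **HEAD-lo — (M4-lo) «A TUBE CELL BELOW THE GLUE CONDUCTOR IS BALANCED, GIVEN THE PLANE FACE» (weighted exchange form).**  Frame as above (`1 ≤ b`, `b + 1 ≤ d`); face in the
free-predicate exchange letters of ★ p860971 §B: SOME admissible flip (`ε·Θε = ξ`, `ρξ = ξ`, `|ξ| = 1`) has `Pf ε`, and EVERY admissible `ε` with `Pf ε` exchanges the labels on the
cell (`P₁ Λ → Q₁ (ε • Λ)`, `Q₁ Λ → P₁ (ε⁻¹ • Λ)`).  THEN the weighted labelled counts agree: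
`Σᶠ_{Λ ∈ levelSetDep(j, b; lam − jE u) ∩ {P₁}} f b j Λ = Σᶠ_{Λ ∈ levelSetDep(j, b; lam − jE u) ∩ {Q₁}} f b j Λ` — both are `q^b ·` the unweighted counts, which agree by ★
`ncard_levelSetDep_sep_eq_of_face_exchange`. (For (β₂-H): `P₁ = +`, `Q₁ = −′`; the flip is the exact ω-flip of the HP-WITNESS-TABLE, admissible exactly below the conductor.)
[cite: Rogawski1990, §4.9 Prop. 4.9.1 (b) p. 55] [cite: Serre1979, Ch. V §3 Prop. 5, Cor. 2–3 pp. 84–86] [cite: Kottwitz1986BaseChangeUnits, §1 pp. 240–241] -/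
theorem finsum_levelSetDep_inter_weight_eq_of_face_exchange_of_succ_le [IsDiscreteValuationRing 𝒪[E]] [Finite 𝓀[E]]
    (σ : E →+* E) (hσ : ∀ a, σ (σ a) = a) (hvσ : ∀ a, Valued.v (σ a) = Valued.v a)
    {ϖ : E} (hϖ : Valued.v ϖ = WithZero.exp (-1 : ℤ)) {d t : ℕ} (hD : IsRamifiedQuadraticDatum σ ϖ d t) (h2v : Valued.v (2 : E) < 1)
    {H₂ : Matrix (Fin 2) (Fin 2) E} (hH₂σ : (H₂.map σ)ᵀ = H₂) {hW : E} (hhW : Valued.v hW = 1) (hhWσ : σ hW = hW) (jE : E →+* M)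
    (hρρ : ∀ x, ρ (ρ x) = x) (hvρ : ∀ x, Valued.v (ρ x) = Valued.v x) (hα : ρ α ≠ α) (hα1 : Valued.v α ≤ 1)
    (hint : ∀ z : M, Valued.v z ≤ 1 → Valued.v ((z - ρ z) / (α - ρ α)) ≤ 1)
    (hΘΘ : ∀ x, Θ (Θ x) = x) (hΘρ : ∀ x, Θ (ρ x) = ρ (Θ x)) (hvΘ : ∀ x, Valued.v (Θ x) = Valued.v x) (hΘj : ∀ x, Θ (jE x) = jE (σ x))
    (hjv : ∀ c, Valued.v (jE c) ≤ 1 ↔ Valued.v c ≤ 1) (hjfix : ∀ z, ρ z = z ↔ ∃ c, jE c = z)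
    (hjpow : ∀ (t : E) (n : ℤ), Valued.v (jE t) = Valued.v (jE ϖ) ^ n ↔ Valued.v t = Valued.v ϖ ^ n)
    (hϖmax : ∀ t : M, ρ t = t → Valued.v t < 1 → Valued.v t ≤ Valued.v (jE ϖ))
    (φ : (Fin 2 → E) →+ M) (hφs : ∀ (c : E) (x : Fin 2 → E), φ (c • x) = jE c * φ x) (hφi : Function.Injective φ) (hφo : Function.Surjective φ)
    {γ₂ : GL (Fin 2) E} {lam h : M} (hφγ : ∀ x, φ ((γ₂ : Matrix (Fin 2) (Fin 2) E).mulVec x) = lam * φ x) (hlam : Valued.v lam = 1)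
    (hΘh : Θ h = h) (hh : h ≠ 0) (hform : ∀ x y, jE (pairing σ H₂ x y) = h * Θ (φ x) * φ y + ρ (h * Θ (φ x) * φ y))
    (u : E) {b : ℕ} (hb : 1 ≤ b) (hbd : b + 1 ≤ d) {j : ℕ} (hlamj : IsOrd ρ α (jE ϖ ^ j) lam)
    (f : ℕ → ℕ → AddSubgroup M → ℕ)
    (hf : ∀ (b j : ℕ) (Λ : AddSubgroup M) (x₀ : M) (r : E), 1 ≤ b → x₀ ≠ 0 →
      (∀ x, x ∈ Λ ↔ ∃ z, IsOrd ρ α (jE ϖ ^ j) z ∧ x = x₀ * z) →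
      IsOrd ρ α (jE ϖ ^ j) (dualGen ρ Θ α (jE ϖ ^ j) h x₀) → ¬ IsOrd ρ α (jE ϖ ^ j) (dualGen ρ Θ α (jE ϖ ^ j) h x₀ / jE ϖ) →
      Valued.v (dualGen ρ Θ α (jE ϖ ^ j) h x₀) = Valued.v (jE ϖ) ^ b →
      (∀ b', (∀ x ∈ Λ, Valued.v (h * Θ x * b' + ρ (h * Θ x * b')) ≤ 1) → (lam - jE u) * b' ∈ Λ) →
      IsOrd ρ α (jE ϖ ^ j) lam → jE r = glueUnit ρ Θ α (jE ϖ ^ j) h (jE ϖ) (jE hW) x₀ b →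
      f b j Λ = Nat.card {x : 𝒪[E] ⧸ 𝓂[E] ^ (2 * b) // ∃ u' : 𝒪[E], Ideal.Quotient.mk (𝓂[E] ^ (2 * b)) u' = x ∧
        Valued.v ((u' : E) * σ u' - r) ≤ Valued.v (ϖ ^ (2 * b))})
    (Pf : M → Prop) (hP : ∃ ε ξ : M, Pf ε ∧ ε * Θ ε = ξ ∧ ρ ξ = ξ ∧ Valued.v ξ = 1) (P₁ Q₁ : AddSubgroup M → Prop)
    (hface : ∀ ε ξ : M, Pf ε → ε * Θ ε = ξ → ρ ξ = ξ → Valued.v ξ = 1 →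
      (∀ Λ ∈ levelSetDep ρ Θ α (jE ϖ) h j b (lam - jE u), P₁ Λ → Q₁ (ε • Λ)) ∧
        (∀ Λ ∈ levelSetDep ρ Θ α (jE ϖ) h j b (lam - jE u), Q₁ Λ → P₁ (ε⁻¹ • Λ))) :
    ∑ᶠ Λ ∈ levelSetDep ρ Θ α (jE ϖ) h j b (lam - jE u) ∩ {Λ | P₁ Λ}, f b j Λ =
      ∑ᶠ Λ ∈ levelSetDep ρ Θ α (jE ϖ) h j b (lam - jE u) ∩ {Λ | Q₁ Λ}, f b j Λ := by
  rw [finsum_levelSetDep_inter_weight_eq_pow_mul_ncard_of_succ_le σ hσ hvσ hϖ hD h2v hH₂σ hhW hhWσ jE hρρ hvρ hα hα1 hint hΘΘ hΘρ hvΘ hΘj hjv hjfix hjpow hϖmax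
      φ hφs hφi hφo hφγ hlam hΘh hh hform u hb hbd hlamj f hf P₁,
    finsum_levelSetDep_inter_weight_eq_pow_mul_ncard_of_succ_le σ hσ hvσ hϖ hD h2v hH₂σ hhW hhWσ jE hρρ hvρ hα hα1 hint hΘΘ hΘρ hvΘ hΘj hjv hjfix hjpow hϖmax
      φ hφs hφi hφo hφγ hlam hΘh hh hform u hb hbd hlamj f hf Q₁]
  congr 1
  exact ncard_levelSetDep_sep_eq_of_face_exchange (α := α) Pf hP (jE ϖ) h j b (lam - jE u) P₁ Q₁ hface

/-- **HEAD-lo-ω — (M4-lo) AT THE ω-FLIP** (class-A «ω-cells»; ★ p860971 §C letters): if every unit of `M` fixed by `ρ` and `Θ` is a `Θ`-norm (`hFN`), the exact ω-flip exists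
(★ `exists_omegaFlip_admissible`: `ε·Θε = jE ξ₀`, `ξ₀` a `σ`-fixed NON-norm of `E`); if every such `ε` exchanges the labels on the cell (the ω-FACE, exchange form), then below the
conductor the weighted labelled counts of the tube cell agree. [cite: Rogawski1990, §4.9 Prop. 4.9.1 (b) p. 55] [cite: Serre1979, Ch. V §3 Cor. 3]
[cite: Kottwitz1986BaseChangeUnits, §1 pp. 240–241] -/
theorem finsum_levelSetDep_inter_weight_eq_of_omegaFace_exchange_of_succ_le [CompleteSpace E] [IsDiscreteValuationRing 𝒪[E]] [Finite 𝓀[E]]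
    (σ : E →+* E) (hσ : ∀ a, σ (σ a) = a) (hvσ : ∀ a, Valued.v (σ a) = Valued.v a)
    {ϖ : E} (hϖ : Valued.v ϖ = WithZero.exp (-1 : ℤ)) {d t : ℕ} (hD : IsRamifiedQuadraticDatum σ ϖ d t) (h2v : Valued.v (2 : E) < 1)
    {H₂ : Matrix (Fin 2) (Fin 2) E} (hH₂σ : (H₂.map σ)ᵀ = H₂) {hW : E} (hhW : Valued.v hW = 1) (hhWσ : σ hW = hW) (jE : E →+* M)
    (hρρ : ∀ x, ρ (ρ x) = x) (hvρ : ∀ x, Valued.v (ρ x) = Valued.v x) (hα : ρ α ≠ α) (hα1 : Valued.v α ≤ 1)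
    (hint : ∀ z : M, Valued.v z ≤ 1 → Valued.v ((z - ρ z) / (α - ρ α)) ≤ 1)
    (hΘΘ : ∀ x, Θ (Θ x) = x) (hΘρ : ∀ x, Θ (ρ x) = ρ (Θ x)) (hvΘ : ∀ x, Valued.v (Θ x) = Valued.v x) (hΘj : ∀ x, Θ (jE x) = jE (σ x))
    (hjv : ∀ c, Valued.v (jE c) ≤ 1 ↔ Valued.v c ≤ 1) (hjfix : ∀ z, ρ z = z ↔ ∃ c, jE c = z)
    (hjpow : ∀ (t : E) (n : ℤ), Valued.v (jE t) = Valued.v (jE ϖ) ^ n ↔ Valued.v t = Valued.v ϖ ^ n)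
    (hϖmax : ∀ t : M, ρ t = t → Valued.v t < 1 → Valued.v t ≤ Valued.v (jE ϖ))
    (hFN : ∀ f₀ : M, ρ f₀ = f₀ → Θ f₀ = f₀ → Valued.v f₀ = 1 → ∃ z : M, z * Θ z = f₀)
    (φ : (Fin 2 → E) →+ M) (hφs : ∀ (c : E) (x : Fin 2 → E), φ (c • x) = jE c * φ x) (hφi : Function.Injective φ) (hφo : Function.Surjective φ)
    {γ₂ : GL (Fin 2) E} {lam h : M} (hφγ : ∀ x, φ ((γ₂ : Matrix (Fin 2) (Fin 2) E).mulVec x) = lam * φ x) (hlam : Valued.v lam = 1)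
    (hΘh : Θ h = h) (hh : h ≠ 0) (hform : ∀ x y, jE (pairing σ H₂ x y) = h * Θ (φ x) * φ y + ρ (h * Θ (φ x) * φ y))
    (u : E) {b : ℕ} (hb : 1 ≤ b) (hbd : b + 1 ≤ d) {j : ℕ} (hlamj : IsOrd ρ α (jE ϖ ^ j) lam)
    (f : ℕ → ℕ → AddSubgroup M → ℕ)
    (hf : ∀ (b j : ℕ) (Λ : AddSubgroup M) (x₀ : M) (r : E), 1 ≤ b → x₀ ≠ 0 →
      (∀ x, x ∈ Λ ↔ ∃ z, IsOrd ρ α (jE ϖ ^ j) z ∧ x = x₀ * z) →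
      IsOrd ρ α (jE ϖ ^ j) (dualGen ρ Θ α (jE ϖ ^ j) h x₀) → ¬ IsOrd ρ α (jE ϖ ^ j) (dualGen ρ Θ α (jE ϖ ^ j) h x₀ / jE ϖ) →
      Valued.v (dualGen ρ Θ α (jE ϖ ^ j) h x₀) = Valued.v (jE ϖ) ^ b →
      (∀ b', (∀ x ∈ Λ, Valued.v (h * Θ x * b' + ρ (h * Θ x * b')) ≤ 1) → (lam - jE u) * b' ∈ Λ) →
      IsOrd ρ α (jE ϖ ^ j) lam → jE r = glueUnit ρ Θ α (jE ϖ ^ j) h (jE ϖ) (jE hW) x₀ b →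
      f b j Λ = Nat.card {x : 𝒪[E] ⧸ 𝓂[E] ^ (2 * b) // ∃ u' : 𝒪[E], Ideal.Quotient.mk (𝓂[E] ^ (2 * b)) u' = x ∧
        Valued.v ((u' : E) * σ u' - r) ≤ Valued.v (ϖ ^ (2 * b))})
    (P₁ Q₁ : AddSubgroup M → Prop)
    (hface : ∀ (ε : M) (ξ₀ : E), ε * Θ ε = jE ξ₀ → σ ξ₀ = ξ₀ → (¬ ∃ e : E, e * σ e = ξ₀) →
      (∀ Λ ∈ levelSetDep ρ Θ α (jE ϖ) h j b (lam - jE u), P₁ Λ → Q₁ (ε • Λ)) ∧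
        (∀ Λ ∈ levelSetDep ρ Θ α (jE ϖ) h j b (lam - jE u), Q₁ Λ → P₁ (ε⁻¹ • Λ))) :
    ∑ᶠ Λ ∈ levelSetDep ρ Θ α (jE ϖ) h j b (lam - jE u) ∩ {Λ | P₁ Λ}, f b j Λ =
      ∑ᶠ Λ ∈ levelSetDep ρ Θ α (jE ϖ) h j b (lam - jE u) ∩ {Λ | Q₁ Λ}, f b j Λ :=
  finsum_levelSetDep_inter_weight_eq_of_face_exchange_of_succ_le σ hσ hvσ hϖ hD h2v hH₂σ hhW hhWσ jE hρρ hvρ hα hα1 hint hΘΘ hΘρ hvΘ hΘj hjv hjfix hjpow hϖmax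
    φ hφs hφi hφo hφγ hlam hΘh hh hform u hb hbd hlamj f hf
    (fun ε => ∃ ξ₀ : E, ε * Θ ε = jE ξ₀ ∧ σ ξ₀ = ξ₀ ∧ ¬ ∃ e : E, e * σ e = ξ₀)
    (exists_omegaFlip_admissible σ hD jE hvΘ hΘj hjfix hjpow hFN) P₁ Q₁
    (fun ε _ ⟨ξ₀, hε, hσξ, hξN⟩ _ _ _ => hface ε ξ₀ hε hσξ hξN)

end Weight

end Summit.HodgeConjecture.HodgeConjecture.Cruxes.H413.F0P3cDyRamConeCellFaceTube

end
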